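import Mathlib
import HarnessLib
import Literature.AlgebraicGeometry.Resolution.AugmentationIdeal
import Summits.ResolutionOfSingularities.ResolutionOfSingularities.Theorems.WildQuotientsWildQuotientResolutionTameFixedLocus

/-!
# Fixed loci of NORMAL tame subgroups are stable permissible centres
# (crux `WildQuotients.WildQuotientResolution`, stub `stub_phaseZeroHighDim`; any dimension)

Crux stmt-ResolutionOfSingularities-15640 (`WildQuotientResolution`), registered stub `stub_phaseZeroHighDim`.
An equivariant blow-up of Phase 0 needs a centre which is (i) regular / cut out by a part of a regular system
of parameters — for the fixed locus of a TAME subgroup `H` of the inertia group this is ✓`TameFixedLocus`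
(p817669) — and (ii) STABLE under the whole inertia group `I = I_x` (and then its `G`-orbit is a disjoint
union of translates near the orbit of `x`). This file supplies (ii): the automorphism `τ g` carries the
fixed-locus ideal of `h` to that of `g h g⁻¹` (`map_augIdeal_le_conj`), so the fixed-locus ideal
`𝔞_H = ⨆_{h ∈ H} I_{τ h}` of a NORMAL subgroup `H ⊴ I` is `τ(I)`-stable (`map_iSup_augIdeal_eq_of_normal`).
With `H` a normal subgroup of order prime to `p` — e.g. the largest normal `p′`-subgroup `O_{p′}(I_x)`, or
the centre `{±1}` of `SL₂(𝔽_p)` (`p` odd) acting linearly on the plane, whose fixed point is the origin: ONE blow-up there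
already makes every inertia group p-closed (Borel subgroups at the `𝔽_p`-points of the exceptional line,
non-split tori at the other closed points, `{±1}` at its generic point) — `𝔞_H` is an `I`-stable ideal
generated by a part of a regular system of parameters with regular local quotient
(`exists_stable_isRsopPart_of_normal_coprime`): a canonical `I_x`-stable permissible tame centre through
`x`, in every dimension.

[OURS · crux stmt-ResolutionOfSingularities-15640 · helper toward `stub_phaseZeroHighDim` (NOT a proof of the
stub); folklore, counted 0; AI-level work, weaker than expert review.] [folklore]

* `apply_inv_apply`, `apply_sub_eq_conj` — `τ g (τ h r − r) = τ (g h g⁻¹) (τ g r) − τ g r`;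
* `map_augIdeal_le_conj` — `τ g (I_{τ h}) ⊆ I_{τ (g h g⁻¹)}`;
* `map_iSup_augIdeal_le_of_normal`, `map_iSup_augIdeal_eq_of_normal`, `apply_mem_iSup_augIdeal_of_normal` —
  the fixed-locus ideal of a normal subgroup is `τ(I)`-stable;
* `exists_stable_isRsopPart_of_normal_coprime` — the packaged statement for a regular local ring of residue
  characteristic `p` and a normal subgroup of order prime to `p` of a residue-trivial `I`.
-/

-- single-problem summit: the doubled namespace component `ResolutionOfSingularities` is forced
set_option linter.dupNamespace false

noncomputable section

namespace Summit.ResolutionOfSingularities.ResolutionOfSingularities.Theorems.WildQuotientResolution.TameFixedLocus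

open IsLocalRing
open Literature.AlgebraicGeometry.Resolution

universe u

section Conj

variable {R : Type*} [CommRing R] {I : Type*} [Group I] (τ : I →* (R ≃+* R))

/-- `τ g⁻¹ (τ g r) = r`. [folklore] -/
theorem apply_inv_apply (g : I) (r : R) : τ g⁻¹ (τ g r) = r := by
  rw [← RingAut.mul_apply, ← map_mul, inv_mul_cancel, map_one, RingAut.one_apply]

/-- Transport of the generators of the fixed-locus ideals: `τ g (τ h r − r) = τ (g h g⁻¹) (τ g r) − τ g r`.
[folklore] -/
theorem apply_sub_eq_conj (g h : I) (r : R) :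
    τ g (τ h r - r) = τ (g * h * g⁻¹) (τ g r) - τ g r := by
  rw [map_sub, map_mul, map_mul, RingAut.mul_apply, RingAut.mul_apply, apply_inv_apply]

/-- **`τ g` carries the fixed-locus ideal of `h` into that of `g h g⁻¹`**:
`(I_{τ h}).map (τ g) ≤ I_{τ (g h g⁻¹)}`. [folklore] -/
theorem map_augIdeal_le_conj (g h : I) :
    (augIdeal (τ h)).map (τ g : R →+* R) ≤ augIdeal (τ (g * h * g⁻¹)) := by
  rw [augIdeal_def (τ h), Ideal.map_span]
  refine Ideal.span_le.mpr ?_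
  rintro _ ⟨_, ⟨r, rfl⟩, rfl⟩
  rw [RingHom.coe_coe, apply_sub_eq_conj]
  exact sub_mem_augIdeal (τ (g * h * g⁻¹)) (τ g r)

variable (H : Subgroup I) [hH : H.Normal]

/-- For a NORMAL subgroup `H`, `τ g` maps the fixed-locus ideal `⨆_{h ∈ H} I_{τ h}` into itself. [folklore] -/
theorem map_iSup_augIdeal_le_of_normal (g : I) :
    (⨆ h : H, augIdeal ((τ.comp H.subtype) h)).map (τ g : R →+* R) ≤
      ⨆ h : H, augIdeal ((τ.comp H.subtype) h) := by
  rw [Ideal.map_iSup]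
  refine iSup_le fun h => (map_augIdeal_le_conj τ g (h : I)).trans ?_
  have hmem : g * (h : I) * g⁻¹ ∈ H := hH.conj_mem (h : I) h.2 g
  exact le_iSup_of_le ⟨g * (h : I) * g⁻¹, hmem⟩ le_rfl

/-- **The fixed-locus ideal of a normal subgroup is `τ(I)`-stable**:
`(⨆_{h ∈ H} I_{τ h}).map (τ g) = ⨆_{h ∈ H} I_{τ h}` for every `g ∈ I`. [folklore] -/
theorem map_iSup_augIdeal_eq_of_normal (g : I) :
    (⨆ h : H, augIdeal ((τ.comp H.subtype) h)).map (τ g : R →+* R) =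
      ⨆ h : H, augIdeal ((τ.comp H.subtype) h) := by
  refine le_antisymm (map_iSup_augIdeal_le_of_normal τ H g) ?_
  set J : Ideal R := ⨆ h : H, augIdeal ((τ.comp H.subtype) h) with hJ
  have hcomp : (τ g : R →+* R).comp (τ g⁻¹ : R →+* R) = RingHom.id R := by
    ext r
    simp only [RingHom.comp_apply, RingHom.coe_coe, RingHom.id_apply]
    rw [← RingAut.mul_apply, ← map_mul, mul_inv_cancel, map_one, RingAut.one_apply]
  calc J = J.map (RingHom.id R) := (Ideal.map_id J).symm
    _ = (J.map (τ g⁻¹ : R →+* R)).map (τ g : R →+* R) := by rw [Ideal.map_map, hcomp]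
    _ ≤ J.map (τ g : R →+* R) := Ideal.map_mono (map_iSup_augIdeal_le_of_normal τ H g⁻¹)

/-- Elementwise form: `x ∈ ⨆_{h ∈ H} I_{τ h} → τ g x ∈ ⨆_{h ∈ H} I_{τ h}`. [folklore] -/
theorem apply_mem_iSup_augIdeal_of_normal (g : I) {x : R}
    (hx : x ∈ ⨆ h : H, augIdeal ((τ.comp H.subtype) h)) :
    τ g x ∈ ⨆ h : H, augIdeal ((τ.comp H.subtype) h) :=
  map_iSup_augIdeal_le_of_normal τ H g (Ideal.mem_map_of_mem (τ g : R →+* R) hx)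

end Conj

section Regular

variable {R : Type u} [CommRing R] [IsRegularLocalRing R] {I : Type*} [Group I] [Finite I]
  (τ : I →* (R ≃+* R)) (H : Subgroup I) [hH : H.Normal]

/-- **A canonical stable permissible tame centre** (crux stmt-ResolutionOfSingularities-15640, toward
`stub_phaseZeroHighDim`; any dimension). Let `(R, 𝔪, κ)` be a regular local ring of residue characteristic
`p`, `τ : I →* (R ≃+* R)` a residue-trivial action of a finite group (an inertia group), and `H ⊴ I` a
normal subgroup of order prime to `p` (e.g. `O_{p′}(I)`). Then the fixed-locus ideal `𝔞_H = ⨆_{h ∈ H} I_{τ h}`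
is `τ(I)`-STABLE, generated by a part of a regular system of parameters, and `R ⧸ 𝔞_H` is a regular local
ring. [folklore] -/
theorem exists_stable_isRsopPart_of_normal_coprime (p : ℕ) [Fact p.Prime] [CharP (ResidueField R) p]
    (hres : ∀ (g : I) (r : R), τ g r - r ∈ maximalIdeal R) (hcop : (Nat.card H).Coprime p) :
    (∀ (g : I) {x : R}, x ∈ (⨆ h : H, augIdeal ((τ.comp H.subtype) h)) →
        τ g x ∈ ⨆ h : H, augIdeal ((τ.comp H.subtype) h)) ∧
      IsRegularLocalRing (R ⧸ ⨆ h : H, augIdeal ((τ.comp H.subtype) h)) ∧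
      ∃ (c : ℕ) (f : Fin c → R), (∀ i, f i ∈ ⨆ h : H, augIdeal ((τ.comp H.subtype) h)) ∧
        Ideal.span (Set.range f) = (⨆ h : H, augIdeal ((τ.comp H.subtype) h)) ∧ IsRsopPart f := by
  have hm : (⨆ h : H, augIdeal ((τ.comp H.subtype) h)) ≤ maximalIdeal R := by
    refine iSup_le fun h => ?_
    rw [augIdeal_def]
    refine Ideal.span_le.mpr ?_
    rintro _ ⟨r, rfl⟩
    exact hres (h : I) r
  obtain ⟨hreg, hgen⟩ := exists_isRsopPart_of_coprime (τ.comp H.subtype) p hcop hm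
  exact ⟨fun g _ hx => apply_mem_iSup_augIdeal_of_normal τ H g hx, hreg, hgen⟩

end Regular

end Summit.ResolutionOfSingularities.ResolutionOfSingularities.Theorems.WildQuotientResolution.TameFixedLocus

end
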